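import Mathlib.Tactic.Linarith
import Mathlib.Tactic.LinearCombination
import Mathlib.Tactic.Positivity
import Mathlib.Tactic.Ring
import HarnessLib

/-!
# `NoHeavyLowerTail` (crux stmt-CriticalPhenomena-4575), P3 lane: the certificate of the row `#dbl = 2` of `(L_t)`, every `t`

Support file (seat `prim-l12-p3`, gen 26; `--supports stmt-CriticalPhenomena-4575`).  Memo g26 §4.16.  Pure integer arithmetic (no set
families): with `n = τ − t + 2`, `P2 = cH(t,n+1)`, `Q2 = cH(t−1,n+1)`, `P1 = cH(t−1,n−1)`, `Q1 = cH(t−2,n−1)`, `R0 = cH(t−2,n−2)` (so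
`cH(t,n+2) = P2+Q2`, `cH(t−1,n) = P1+Q1` by Pascal), the five normalised supply facts of the row — plain t-DENSITY (`N2P`) and PINNED
t-density summed over both doubled points (`N2Q`) on the restriction cubes, plain (`N1P`) and pinned (`N1Q`) `(t−1)`-density on the link
cubes (summed over the two doubled points), `(t−2)`-density on the double-link cubes (`N0`) — imply the charge bound
`(P2+Q2)·a + (P1+Q1)·q + R0·ε ≤ ΣR + ΣM + ΣL` whenever the four elimination multipliers are nonnegative (`rowTwoT_arith`; the combination
is the identity `rowTwoT_identity`).  The sign conditions hold for `n ≥ 2t − 2` (`t ≥ 4`; `n ≥ 6` for `t = 3`), checked exactly for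
`t ≤ 8`, `n ≤ 6t`; their general proof and the set-family facts are the remaining steps to ROW 2 OF `(L_t)` for every `t`.
Nothing is asserted about the crux.
-/

namespace Summit.CriticalPhenomena.PercolationContinuityZ3.Theorems.SahiCTCForms

/-- The elimination identity behind the row-`2` certificate of `(L_t)` (free in all symbols). [this work] -/
theorem rowTwoT_identity (n t P2 Q2 P1 Q1 R0 a q e SR SM SL : ℤ) :
    ((((P2 + Q2) * t * (t - 1) * (n - t + 2) * (n - t + 1)) * (2 * (n + 1) * n * (n - 1)) - ((n + 2) * (n + 1) * n * (n - 1)) * (2 * Q2 * t * (t - 1) * (n - t + 1))) * ((t - 1) * ((P1 + Q1) * (n - t + 1) - n * Q1)) * t * (t - 1)) * (SR + SM + SL) - ((((P2 + Q2) * t * (t - 1) * (n - t + 2) * (n - t + 1)) * (2 * (n + 1) * n * (n - 1)) - ((n + 2) * (n + 1) * n * (n - 1)) * (2 * Q2 * t * (t - 1) * (n - t + 1))) * ((t - 1) * ((P1 + Q1) * (n - t + 1) - n * Q1)) * t * (t - 1)) * ((P2 + Q2) * a + (P1 + Q1) * q + R0 * e) =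
      ((R0 * (2 * (n + 1) * n * (n - 1)) - (2 * Q2 * t * (t - 1) * (n - t + 1))) * ((t - 1) * ((P1 + Q1) * (n - t + 1) - n * Q1)) * (t * (t - 1))) * (((n + 2) * (n + 1) * n * (n - 1)) * SR - (P2 + Q2) * t * (t - 1) * (n * (n - 1) * a + (n - 1) * (n - t + 2) * q + (n - t + 2) * (n - t + 1) * e))
      + ((((P2 + Q2) * t * (t - 1) * (n - t + 2) * (n - t + 1)) - ((n + 2) * (n + 1) * n * (n - 1)) * R0) * ((t - 1) * ((P1 + Q1) * (n - t + 1) - n * Q1)) * (t * (t - 1))) * ((2 * (n + 1) * n * (n - 1)) * SR - (P2 * (t - 1) * (2 * n * (n - 1) * a + (n - 1) * (n - t + 2) * q) + Q2 * t * (t - 1) * ((n - 1) * q + 2 * (n - t + 1) * e)))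
      + ((t - 1) * (t * (t - 1)) * ((((P2 + Q2) * t * (t - 1) * (n - t + 2) * (n - t + 1)) * (2 * (n + 1) * n * (n - 1)) - ((n + 2) * (n + 1) * n * (n - 1)) * (2 * Q2 * t * (t - 1) * (n - t + 1))) * P1 - (R0 * (2 * (n + 1) * n * (n - 1)) - (2 * Q2 * t * (t - 1) * (n - t + 1))) * ((P2 + Q2) * t * (t - 1) * (n - 1) * (n - t + 2)) - (((P2 + Q2) * t * (t - 1) * (n - t + 2) * (n - t + 1)) - ((n + 2) * (n + 1) * n * (n - 1)) * R0) * (P2 * (t - 1) * (n - 1) * (n - t + 2) + Q2 * t * (t - 1) * (n - 1)))) * (n * SM - (P1 + Q1) * (2 * n * a + (n - t + 1) * q))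
      + ((t * (t - 1)) * (n * ((R0 * (2 * (n + 1) * n * (n - 1)) - (2 * Q2 * t * (t - 1) * (n - t + 1))) * ((P2 + Q2) * t * (t - 1) * (n - 1) * (n - t + 2)) + (((P2 + Q2) * t * (t - 1) * (n - t + 2) * (n - t + 1)) - ((n + 2) * (n + 1) * n * (n - 1)) * R0) * (P2 * (t - 1) * (n - 1) * (n - t + 2) + Q2 * t * (t - 1) * (n - 1))) - (t - 1) * (((P2 + Q2) * t * (t - 1) * (n - t + 2) * (n - t + 1)) * (2 * (n + 1) * n * (n - 1)) - ((n + 2) * (n + 1) * n * (n - 1)) * (2 * Q2 * t * (t - 1) * (n - t + 1))) * (P1 + Q1))) * ((t - 1) * SM - (2 * n * P1 * a + (t - 1) * Q1 * q))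
      + ((((P2 + Q2) * t * (t - 1) * (n - t + 2) * (n - t + 1)) * (2 * (n + 1) * n * (n - 1)) - ((n + 2) * (n + 1) * n * (n - 1)) * (2 * Q2 * t * (t - 1) * (n - t + 1))) * ((t - 1) * ((P1 + Q1) * (n - t + 1) - n * Q1))) * (t * (t - 1) * SL - R0 * n * (n - 1) * a) := by
  ring

/-- **The row-`2` certificate of `(L_t)`**: the five normalised facts and the four sign conditions give the charge bound. [this work] -/
theorem rowTwoT_arith {n t P2 Q2 P1 Q1 R0 a q e a' q' e' SR SM SL : ℤ} (ht : 2 ≤ t)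
    (N2P : (P2 + Q2) * t * (t - 1) * (n * (n - 1) * a + (n - 1) * (n - t + 2) * q + (n - t + 2) * (n - t + 1) * e) ≤ ((n + 2) * (n + 1) * n * (n - 1)) * SR)
    (N2Q : P2 * (t - 1) * (2 * n * (n - 1) * a + (n - 1) * (n - t + 2) * q) + Q2 * t * (t - 1) * ((n - 1) * q + 2 * (n - t + 1) * e)
      ≤ (2 * (n + 1) * n * (n - 1)) * SR)
    (N1P : (P1 + Q1) * (2 * n * a + (n - t + 1) * q) ≤ n * SM) (N1Q : 2 * n * P1 * a + (t - 1) * Q1 * q ≤ (t - 1) * SM)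
    (N0 : R0 * n * (n - 1) * a ≤ t * (t - 1) * SL)
    (hu : 0 ≤ (R0 * (2 * (n + 1) * n * (n - 1)) - (2 * Q2 * t * (t - 1) * (n - t + 1)))) (hv : 0 ≤ (((P2 + Q2) * t * (t - 1) * (n - t + 2) * (n - t + 1)) - ((n + 2) * (n + 1) * n * (n - 1)) * R0)) (hdet : 0 < (((P2 + Q2) * t * (t - 1) * (n - t + 2) * (n - t + 1)) * (2 * (n + 1) * n * (n - 1)) - ((n + 2) * (n + 1) * n * (n - 1)) * (2 * Q2 * t * (t - 1) * (n - t + 1)))) (hd2 : 0 < ((t - 1) * ((P1 + Q1) * (n - t + 1) - n * Q1)))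
    (h1P : 0 ≤ (((P2 + Q2) * t * (t - 1) * (n - t + 2) * (n - t + 1)) * (2 * (n + 1) * n * (n - 1)) - ((n + 2) * (n + 1) * n * (n - 1)) * (2 * Q2 * t * (t - 1) * (n - t + 1))) * P1 - (R0 * (2 * (n + 1) * n * (n - 1)) - (2 * Q2 * t * (t - 1) * (n - t + 1))) * ((P2 + Q2) * t * (t - 1) * (n - 1) * (n - t + 2)) - (((P2 + Q2) * t * (t - 1) * (n - t + 2) * (n - t + 1)) - ((n + 2) * (n + 1) * n * (n - 1)) * R0) * (P2 * (t - 1) * (n - 1) * (n - t + 2) + Q2 * t * (t - 1) * (n - 1)))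
    (h1Q : 0 ≤ n * ((R0 * (2 * (n + 1) * n * (n - 1)) - (2 * Q2 * t * (t - 1) * (n - t + 1))) * ((P2 + Q2) * t * (t - 1) * (n - 1) * (n - t + 2)) + (((P2 + Q2) * t * (t - 1) * (n - t + 2) * (n - t + 1)) - ((n + 2) * (n + 1) * n * (n - 1)) * R0) * (P2 * (t - 1) * (n - 1) * (n - t + 2) + Q2 * t * (t - 1) * (n - 1))) - (t - 1) * (((P2 + Q2) * t * (t - 1) * (n - t + 2) * (n - t + 1)) * (2 * (n + 1) * n * (n - 1)) - ((n + 2) * (n + 1) * n * (n - 1)) * (2 * Q2 * t * (t - 1) * (n - t + 1))) * (P1 + Q1))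
    (hA2 : 0 ≤ P2 + Q2) (hR1 : 0 ≤ P1 + Q1) (hR0 : 0 ≤ R0) (ha : a' ≤ a) (hq : q' ≤ q) (he : e' ≤ e) :
    (P2 + Q2) * a' + (P1 + Q1) * q' + R0 * e' ≤ SR + SM + SL := by
  have ma := mul_le_mul_of_nonneg_left ha hA2
  have mq := mul_le_mul_of_nonneg_left hq hR1
  have me := mul_le_mul_of_nonneg_left he hR0
  have hmono : (P2 + Q2) * a' + (P1 + Q1) * q' + R0 * e' ≤ ((P2 + Q2) * a + (P1 + Q1) * q + R0 * e) := by linarith only [ma, mq, me]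
  refine hmono.trans ?_
  have hid := rowTwoT_identity n t P2 Q2 P1 Q1 R0 a q e SR SM SL
  have ht0 : (0 : ℤ) < t := by linarith only [ht]
  have ht1 : (0 : ℤ) < t - 1 := by linarith only [ht]
  have htt : (0 : ℤ) ≤ t * (t - 1) := (mul_pos ht0 ht1).le
  have hK : 0 < ((((P2 + Q2) * t * (t - 1) * (n - t + 2) * (n - t + 1)) * (2 * (n + 1) * n * (n - 1)) - ((n + 2) * (n + 1) * n * (n - 1)) * (2 * Q2 * t * (t - 1) * (n - t + 1))) * ((t - 1) * ((P1 + Q1) * (n - t + 1) - n * Q1)) * t * (t - 1)) := mul_pos (mul_pos (mul_pos hdet hd2) ht0) ht1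
  have s2P : 0 ≤ (((n + 2) * (n + 1) * n * (n - 1)) * SR - (P2 + Q2) * t * (t - 1) * (n * (n - 1) * a + (n - 1) * (n - t + 2) * q + (n - t + 2) * (n - t + 1) * e)) := sub_nonneg.2 N2P
  have s2Q : 0 ≤ ((2 * (n + 1) * n * (n - 1)) * SR - (P2 * (t - 1) * (2 * n * (n - 1) * a + (n - 1) * (n - t + 2) * q) + Q2 * t * (t - 1) * ((n - 1) * q + 2 * (n - t + 1) * e))) := sub_nonneg.2 N2Q
  have s1P : 0 ≤ (n * SM - (P1 + Q1) * (2 * n * a + (n - t + 1) * q)) := sub_nonneg.2 N1P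
  have s1Q : 0 ≤ ((t - 1) * SM - (2 * n * P1 * a + (t - 1) * Q1 * q)) := sub_nonneg.2 N1Q
  have s0 : 0 ≤ (t * (t - 1) * SL - R0 * n * (n - 1) * a) := sub_nonneg.2 N0
  have hRHS : 0 ≤ ((R0 * (2 * (n + 1) * n * (n - 1)) - (2 * Q2 * t * (t - 1) * (n - t + 1))) * ((t - 1) * ((P1 + Q1) * (n - t + 1) - n * Q1)) * (t * (t - 1))) * (((n + 2) * (n + 1) * n * (n - 1)) * SR - (P2 + Q2) * t * (t - 1) * (n * (n - 1) * a + (n - 1) * (n - t + 2) * q + (n - t + 2) * (n - t + 1) * e))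
      + ((((P2 + Q2) * t * (t - 1) * (n - t + 2) * (n - t + 1)) - ((n + 2) * (n + 1) * n * (n - 1)) * R0) * ((t - 1) * ((P1 + Q1) * (n - t + 1) - n * Q1)) * (t * (t - 1))) * ((2 * (n + 1) * n * (n - 1)) * SR - (P2 * (t - 1) * (2 * n * (n - 1) * a + (n - 1) * (n - t + 2) * q) + Q2 * t * (t - 1) * ((n - 1) * q + 2 * (n - t + 1) * e)))
      + ((t - 1) * (t * (t - 1)) * ((((P2 + Q2) * t * (t - 1) * (n - t + 2) * (n - t + 1)) * (2 * (n + 1) * n * (n - 1)) - ((n + 2) * (n + 1) * n * (n - 1)) * (2 * Q2 * t * (t - 1) * (n - t + 1))) * P1 - (R0 * (2 * (n + 1) * n * (n - 1)) - (2 * Q2 * t * (t - 1) * (n - t + 1))) * ((P2 + Q2) * t * (t - 1) * (n - 1) * (n - t + 2)) - (((P2 + Q2) * t * (t - 1) * (n - t + 2) * (n - t + 1)) - ((n + 2) * (n + 1) * n * (n - 1)) * R0) * (P2 * (t - 1) * (n - 1) * (n - t + 2) + Q2 * t * (t - 1) * (n - 1)))) * (n * SM - (P1 + Q1) * (2 *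 n * a + (n - t + 1) * q))
      + ((t * (t - 1)) * (n * ((R0 * (2 * (n + 1) * n * (n - 1)) - (2 * Q2 * t * (t - 1) * (n - t + 1))) * ((P2 + Q2) * t * (t - 1) * (n - 1) * (n - t + 2)) + (((P2 + Q2) * t * (t - 1) * (n - t + 2) * (n - t + 1)) - ((n + 2) * (n + 1) * n * (n - 1)) * R0) * (P2 * (t - 1) * (n - 1) * (n - t + 2) + Q2 * t * (t - 1) * (n - 1))) - (t - 1) * (((P2 + Q2) * t * (t - 1) * (n - t + 2) * (n - t + 1)) * (2 * (n + 1) * n * (n - 1)) - ((n + 2) * (n + 1) * n * (n - 1)) * (2 * Q2 * t * (t - 1) * (n - t + 1))) * (P1 + Q1))) * ((t - 1) * SM - (2 * n * P1 * a + (t - 1) * Q1 * q))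
      + ((((P2 + Q2) * t * (t - 1) * (n - t + 2) * (n - t + 1)) * (2 * (n + 1) * n * (n - 1)) - ((n + 2) * (n + 1) * n * (n - 1)) * (2 * Q2 * t * (t - 1) * (n - t + 1))) * ((t - 1) * ((P1 + Q1) * (n - t + 1) - n * Q1))) * (t * (t - 1) * SL - R0 * n * (n - 1) * a) := by
    refine add_nonneg (add_nonneg (add_nonneg (add_nonneg ?_ ?_) ?_) ?_) ?_
    · exact mul_nonneg (mul_nonneg (mul_nonneg hu hd2.le) htt) s2P
    · exact mul_nonneg (mul_nonneg (mul_nonneg hv hd2.le) htt) s2Q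
    · exact mul_nonneg (mul_nonneg (mul_nonneg ht1.le htt) h1P) s1P
    · exact mul_nonneg (mul_nonneg htt h1Q) s1Q
    · exact mul_nonneg (mul_nonneg hdet.le hd2.le) s0
  rw [← hid] at hRHS
  refine le_of_mul_le_mul_left ?_ hK
  linarith only [hRHS]

end Summit.CriticalPhenomena.PercolationContinuityZ3.Theorems.SahiCTCForms
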